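import Mathlib

/-!
# A cyclic tournament of five sets whose difference pencil has a GOLDEN-RATIO eigenvalue

Helper file for crux `stmt-CriticalPhenomena-4575` (`NoHeavyLowerTail`, route `PercNearOneGluingNoHeavy`),
new-inequality factory seat `prim-ineq-gen-3` (gen 26).  Everything here is PROVED; no definitions.

Background (memos `run/shared/lean/prim/prim-ineq-gen-3/CONJECTURE-ORD.md`, `FINDINGS-gen26.md`).  For a finite family
`𝒜` of finite sets the pencil row of a member `C` is `E ↦ [E ⊆ C] + t [E ∩ C = ∅]`.  CONJECTURE ORD (gen 25) says that
for an ADMISSIBLE LINEAR ORDER `A₁, …, Aₘ` (`i < j ⟹ Aᵢ ⊄ Aⱼ`) the rows restricted to the columns `∅` and `Aᵢ \ Aⱼ`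
(`i < j`) — one difference per pair, oriented by a TRANSITIVE tournament — are independent for every complex `t ≠ ±1`.
Gen 26 observed that for an ARBITRARY tournament (one of `Aᵢ \ Aⱼ`, `Aⱼ \ Aᵢ` per pair) the eigenvalues are still roots
of unity for all families of at most four sets (all 129 528 incidence types, exact computation) — but NOT from five sets
on.  This file records the smallest kind of counterexample, showing that ACYCLICITY of the orientation is essential in
CONJECTURE ORD:

the five sets `{0,1}, {2}, {1,2}, {0,4}, {0,2,4}` with the (cyclic) tournament
`{1,2}→{2}, {0,2,4}→{2}, {0,2,4}→{0,4}, {0,1}→{2}, {1,2}→{0,1}, {0,1}→{0,4}, {0,1}→{0,2,4}, {0,4}→{2}, {0,4}→{1,2},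
{0,2,4}→{1,2}` have the tournament differences `{1}, {0,4}, {2}, {0,1}, {2}, {1}, {1}, {0,4}, {0,4}, {0,4}`, i.e. the column
set `T = {∅, {1}, {2}, {0,1}, {0,4}}`, and over EVERY field the vector `(1, -1-t, -1, -1, 2+t)` kills all five columns as
soon as `t² + t = 1`; such `t` (the golden-ratio conjugates `(-1 ± √5)/2` over `ℝ`) satisfy `t² ≠ 1`.  So the tournament
pencil has the non-cyclotomic eigenvalue factor `t² + t - 1`, whereas all 25 transitive tournaments (= admissible orders)
of the same family give only `t = ±1`.
* `cyclicTournament_five_sets_sdiff` — the ten tournament differences and the non-containments making the arcs legal;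
* `cyclicTournament_five_sets_sum_zero` — the kernel identity over any field with `t² + t = 1`;
* `cyclicTournament_five_sets_not_linearIndependent` — the rows are dependent there, and `t² ≠ 1`.
(prim-ineq-gen-3 gen 26, 2026-08-25.)
-/

namespace Summit.CriticalPhenomena.PercolationContinuityZ3.Theorems

namespace OrderedDifferences

open Finset

/-- The ten tournament differences of `({0,1}, {2}, {1,2}, {0,4}, {0,2,4})` for the cyclic tournament of the module
docstring are `{1}, {0,4}, {2}, {0,1}, {2}, {1}, {1}, {0,4}, {0,4}, {0,4}` (all non-empty, so every arc is a legal
orientation of its pair); together with `∅` the column set is `{∅, {1}, {2}, {0,1}, {0,4}}`. -/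
theorem cyclicTournament_five_sets_sdiff :
    (({1, 2} : Finset (Fin 5)) \ {2} = {1}) ∧ (({0, 2, 4} : Finset (Fin 5)) \ {2} = {0, 4}) ∧
    (({0, 2, 4} : Finset (Fin 5)) \ {0, 4} = {2}) ∧ (({0, 1} : Finset (Fin 5)) \ {2} = {0, 1}) ∧
    (({1, 2} : Finset (Fin 5)) \ {0, 1} = {2}) ∧ (({0, 1} : Finset (Fin 5)) \ {0, 4} = {1}) ∧
    (({0, 1} : Finset (Fin 5)) \ {0, 2, 4} = {1}) ∧ (({0, 4} : Finset (Fin 5)) \ {2} = {0, 4}) ∧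
    (({0, 4} : Finset (Fin 5)) \ {1, 2} = {0, 4}) ∧ (({0, 2, 4} : Finset (Fin 5)) \ {1, 2} = {0, 4}) := by
  decide

/-- Over any field with `t² + t = 1`, the vector `(1, -1-t, -1, -1, 2+t)` on `({0,1}, {2}, {1,2}, {0,4}, {0,2,4})` kills
every column `E ∈ {∅, {1}, {2}, {0,1}, {0,4}}` of the tournament pencil: `∑_C c_C ([E ⊆ C] + t [E ∩ C = ∅]) = 0`
(the columns `{1}`, `{2}`, `∅` are killed identically in `t`, the columns `{0,1}`, `{0,4}` give `1 - t - t²`). -/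
theorem cyclicTournament_five_sets_sum_zero {K : Type*} [Field K] (t : K) (ht : t ^ 2 + t = 1) :
    ∀ E ∈ ({∅, {1}, {2}, {0, 1}, {0, 4}} : Finset (Finset (Fin 5))),
      ∑ C ∈ ({{0, 1}, {2}, {1, 2}, {0, 4}, {0, 2, 4}} : Finset (Finset (Fin 5))),
        (if C = {0, 1} then (1 : K) else if C = {2} then -1 - t else if C = {0, 2, 4} then 2 + t else -1) *
          ((if E ⊆ C then (1 : K) else 0) + t * (if Disjoint E C then (1 : K) else 0)) = 0 := by
  intro E hE
  simp only [mem_insert, mem_singleton] at hE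
  rcases hE with rfl | rfl | rfl | rfl | rfl <;>
    · simp (config := { decide := true }) [sum_insert, sum_singleton]
      first
        | linear_combination (0 : K) * ht
        | linear_combination (-1 : K) * ht

/-- **Acyclicity is essential in CONJECTURE ORD.**  For the five sets `{0,1}, {2}, {1,2}, {0,4}, {0,2,4}` and the column set
`T = {∅, {1}, {2}, {0,1}, {0,4}}` of the cyclic tournament of the module docstring, the pencil rows
`C ↦ (E ↦ [E ⊆ C] + t [E ∩ C = ∅])` (`E ∈ T`) are linearly DEPENDENT over every field in which `t² + t = 1`, and such a
`t` has `t² ≠ 1` (over `ℝ`: `t = (-1 ± √5)/2`, the golden-ratio conjugates). -/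
theorem cyclicTournament_five_sets_not_linearIndependent {K : Type*} [Field K] (t : K) (ht : t ^ 2 + t = 1) :
    t ^ 2 ≠ 1 ∧
    ¬ LinearIndependent K
      (fun C : ({{0, 1}, {2}, {1, 2}, {0, 4}, {0, 2, 4}} : Finset (Finset (Fin 5))) =>
        fun E : ({∅, {1}, {2}, {0, 1}, {0, 4}} : Finset (Finset (Fin 5))) =>
          (if (E : Finset (Fin 5)) ⊆ (C : Finset (Fin 5)) then (1 : K) else 0) +
            t * (if Disjoint (E : Finset (Fin 5)) (C : Finset (Fin 5)) then (1 : K) else 0)) := by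
  refine ⟨?_, ?_⟩
  · intro h1
    have ht0 : t = 0 := by linear_combination ht - h1
    rw [ht0] at h1
    norm_num at h1
  rw [Fintype.not_linearIndependent_iff]
  refine ⟨fun C => if (C : Finset (Fin 5)) = {0, 1} then (1 : K) else if (C : Finset (Fin 5)) = {2} then -1 - t
      else if (C : Finset (Fin 5)) = {0, 2, 4} then 2 + t else -1, ?_, ⟨⟨{0, 1}, by simp⟩, by simp⟩⟩
  funext E
  obtain ⟨E, hE⟩ := E
  simp only [Finset.sum_apply, Pi.smul_apply, smul_eq_mul, Pi.zero_apply]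
  have e : (∑ C : ({{0, 1}, {2}, {1, 2}, {0, 4}, {0, 2, 4}} : Finset (Finset (Fin 5))),
      (if (C : Finset (Fin 5)) = {0, 1} then (1 : K) else if (C : Finset (Fin 5)) = {2} then -1 - t
        else if (C : Finset (Fin 5)) = {0, 2, 4} then 2 + t else -1) *
        ((if E ⊆ (C : Finset (Fin 5)) then (1 : K) else 0) +
          t * (if Disjoint E (C : Finset (Fin 5)) then (1 : K) else 0))) =
      ∑ C ∈ ({{0, 1}, {2}, {1, 2}, {0, 4}, {0, 2, 4}} : Finset (Finset (Fin 5))),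
        (if C = {0, 1} then (1 : K) else if C = {2} then -1 - t else if C = {0, 2, 4} then 2 + t else -1) *
          ((if E ⊆ C then (1 : K) else 0) + t * (if Disjoint E C then (1 : K) else 0)) :=
    Finset.sum_coe_sort _ (fun C => (if C = {0, 1} then (1 : K) else if C = {2} then -1 - t
        else if C = {0, 2, 4} then 2 + t else -1) *
      ((if E ⊆ C then (1 : K) else 0) + t * (if Disjoint E C then (1 : K) else 0)))
  rw [e]
  exact cyclicTournament_five_sets_sum_zero t ht E hE

end OrderedDifferences

end Summit.CriticalPhenomena.PercolationContinuityZ3.Theorems
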